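import Summits.BirchSwinnertonDyer.BirchSwinnertonDyer.Theorems.AlignedTransportAtTwoMainConjectureOfRankZeroBSDAtTwoSeedTwoTorsion
import Summits.BirchSwinnertonDyer.Rank1Residual.X2.GreenbergVatsalReductionDatum
import Literature.NumberTheory.EllipticCurves.BSDSelmerSmithCaseVProofs
import HarnessLib

/-!
# Route `AlignedTransportAtTwo`, crux C2 `MainConjectureOfRankZeroBSDAtTwo` (stmt-BirchSwinnertonDyer-22298), line `birth`:
# PERFECT DESCENT OF THE ORDINARY `E[2]`-STRUCTURE (the lead's O1, sufficiency half, print-free) — stub T at `(W, κ)` FOLLOWS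
# from the finiteness of the `Gal(ℚ̄/ℚ_∞)`-invariant part of Greenberg–Vatsal's ordinary `E[2]`-Selmer structure over the
# sextic tower `F_∞ = ℚ_∞(E[2])` (PART XVII of the att-p3 dictionary)

HONEST FRAMING (cell `bsd-f1-sign2`, WIDTH-5 attach seat `bsd-line-att-p3` g7; `--supports stmt-BirchSwinnertonDyer-22298 --as helper`;
BSD is NOT proved by any of this; the crux C2 stays OPEN — «blocked-on `Rank1Residual.GreenbergMuConjectureIrreducible`», C2 ⟺ stub T
mod PRINT, p583329). THEOREMS ONLY — no definition, no named fact, no `sorry`; C2-NEUTRAL (closes nothing: it REDUCES T at `(W, κ)` to an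
explicit Galois-theoretic finiteness over `ℚ_∞(W[2])`, which is itself open). Imports NO route file.

THE OBJECT. For `E = W/ℚ` globally minimal with good reduction at `2`, `M = E[2^∞]` (`W.geomPrimaryTorsion 2`), Greenberg's reduction
datum `L = (C_v = ker(E[2^∞] → Ẽ(k̄_v)))_{v ∣ 2}` (`X2.GreenbergVatsalReductionDatum.reductionData`), `Σ₀ ⊇` the odd bad primes, and a
subgroup `H ≤ Γ_ℚ` with fixed field `L`, the tree's `X2.GreenbergVatsalTorsion.gvSelmer H (M[2]) 2 (torsionData L 2) Σ₀ ⊆ H¹(H, E[2^∞][2])` is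
Greenberg–Vatsal's non-primitive ORDINARY structure with `E[2]`-coefficients over `L`: classes unramified at every finite `v ∉ Σ₀ ∪ {2}` and
with `res ↦ 0 ∈ H¹(H ⊓ I_v, E[2]/Ê[2])` above `2` (image of inertia inside the canonical line `ℓ = Ê[2] = C_2 ∩ E[2]`), nothing at
`Σ₀` and `∞`. Over `F_∞ = ℚ_∞(E[2])` (`H′ = ker κ ⊓ ker ρ̄_{E,2}`, which acts TRIVIALLY on `E[2]`) its classes are continuous
homomorphisms `φ : Gal(ℚ̄/F_∞) → E[2]` with `φ(I_w) = 0` at `w ∤ 2Σ₀` and `φ(I_w) ⊆ Ê[2]` at `w ∣ 2` — the lead's `Hom(𝒳_ord(F_∞), E[2])`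
(CENSUS-lead-g4 (O1)), short of class field theory.

## What is proved

§1 (generic: any number field `K`, discrete `Γ_K`-module `M`, prime `p`, Greenberg data `L`, set `Σ₀`, normal `H₁ ≤ H₂ ≤ Γ_K`):
`resOfLe_mem_unramKer`, `resOfLe_mem_greenbergKer`, **`resOfLe_mem_gvSelmer`** (restriction `H¹(H₂, M) → H¹(H₁, M)` carries
`S^{Σ₀}_M(K̄^{H₂})` into `S^{Σ₀}_M(K̄^{H₁})`), `image_resOfLe_gvSelmer_subset_invariants` (its image is `H₂`-invariant),
`finite_gvSelmer_of_finite_invariants_of_injective` (if `res` is injective, finiteness DESCENDS from the invariant part upstairs).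

§2 (any field `K` with `2 ≠ 0`, elliptic `W`): the Klein module `E[2^∞][2]` — `add_self_torsionBy_two`, `natCard_torsionBy_two` (`= 4`, via
`E[2] ≃ E[2^∞][2]`), `mem_ker_galoisRepTorsion_two_of_forall_smul_torsionBy_eq`; hence (att-p3 g4 part II, `PerfectDescent.resOfLe_injective_of_klein`:
`H¹(Q̄, V₄) = 0` for every `Q̄ ≤ Aut(V₄) ≅ S₃`) **`resOfLe_torsionBy_two_injective`: `H¹(H, E[2^∞][2]) ↪ H¹(H ⊓ ker ρ̄_{E,2}, E[2^∞][2])`**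
for EVERY `H ≤ Γ_K`.

§3 (`K = ℚ`, `p = 2`, `W` globally minimal with good reduction at `2`, `κ` ANY `ℤ₂`-extension of `ℚ`, `Σ₀ ⊇` odd bad primes):
* `finite_selmer_twoTorsion_of_finite_gvSelmer_twoTorsion`: `S^{Σ₀}_{E[2]}(ℚ_∞^κ)` finite ⟹ `Sel_{2^∞}(W/ℚ_∞^κ)[2]` finite — the tree's link
  `Sel_{2^∞} ⊆ S^{Σ₀}_{E[2^∞]}` (`selmerInfty_le_gvSelmerInfty_of_hasGoodReductionAtPrime`, Greenberg's datum, NO hypothesis) and GV's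
  exact coefficient comparison `α(S^{Σ₀}_{E[2]}) = S^{Σ₀}_{E[2^∞]} ⊓ H¹[2]` (`map_gvSelmer_torsion_eq`, Prop. 2.8 without `H⁰ = 0`);
* **`finite_selmer_twoTorsion_of_finite_invariants_divisionTower`**: if the set of `Gal(ℚ̄/ℚ_∞)`-INVARIANT classes of
  `S^{Σ₀}_{E[2]}(F_∞)`, `F_∞ = ℚ_∞(E[2])`, is finite, then `Sel_{2^∞}(W/ℚ_∞)[2]` is finite (§1 + §2);
* **`isTorsion_and_mu_eq_zero_of_finite_invariants_divisionTower`**: … hence `X(W/ℚ_∞)` is `Λ`-torsion with `μ₂ = 0` for every dual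
  datum over a topological generator — THE REGISTERED STUB T of line `birth` AT `(W, κ)`, from an explicit, `E[2^∞]`-free, CFT-free
  finiteness over the sextic tower (PART XVI `finite_pTorsion_iff_isTorsion_and_mu_eq_zero`).

SCOPE — `Δ_W < 0` (precision added in a text-only follow-up; no statement changed): the theorems of §3 are implications and hold as stated,
but their finiteness HYPOTHESIS is satisfiable only when `Δ_W < 0`. Greenberg–Vatsal's `gvSelmer` has NO archimedean slot («vacuous for odd
p»); at `p = 2` with `Δ_W > 0` the `∞`-free structure `S^{Σ₀}_{E[2^∞]}(ℚ_∞)` over the totally real `ℚ_∞` contains the relaxed-at-`∞` Selmer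
group, whose dual has `μ ≥ 1` (Greenberg LNM 1716 Lemma 4.6 at `2`, typed p608868; kernel `…FineRoad.ArchKernel.one_le_lengthAt_ker_archExtension`),
so `S^{Σ₀}_{E[2]}(ℚ_∞)` and its invariant image upstairs are infinite for every `Δ_W > 0` curve, independently of T. For `Δ_W < 0` complex
conjugation moves a `2`-torsion point, `H¹(ℝ, E[2^∞]) = 0` (`…FineRoad.LocalArch.infKer_eq_top_of_Δ_neg`), no archimedean condition is missing, and the
hypothesis is the honest O1 statement (75 % of the seed cell, all certified seeds — the same half-cell as the lead's sextic criterion). A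
version for `Δ_W > 0` needs the STRICT-at-`∞` ordinary structure (`GreenbergSelmer.selmerGroupOver` with `infKer`), not typed here.

What is NOT claimed: the converse (T ⟹ that finiteness) — it needs the PRINTED equality `Sel_{2^∞}(ℚ_∞) = S_{E[2^∞]}(ℚ_∞)` up to
`μ`-neutral terms (Greenberg LNM 1716 Props. 2.1–2.4 + GV Prop. 2.4 at `p = 2`) and the surjective half of the descent (part V + local `H²`);
nor any class-field-theoretic naming of the Hom-set. BSD is not proved by any of this.
References: R. Greenberg, V. Vatsal, Invent. Math. 142 (2000) §2 (pp. 16–25, Prop. 2.8); R. Greenberg, LNM 1716 §§1–2; J.-P. Serre,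
*Galois Cohomology* I §2.6; J. Silverman, AEC VII.4.1, X.4.
-/

set_option linter.dupNamespace false
set_option autoImplicit false

noncomputable section

open scoped Classical AddSubgroup

namespace Summit.BirchSwinnertonDyer.BirchSwinnertonDyer.Theorems.AlignedTransportAtTwoSeedTwoTorsion

open NumberField IsDedekindDomain Field WeierstrassCurve
open Literature.NumberTheory.EllipticCurves Literature.NumberTheory.EllipticCurves.GreenbergSelmer
  Literature.NumberTheory.GaloisRepresentations
  Summit.BirchSwinnertonDyer.Rank1Residual.X2.TorsionComparison
  Summit.BirchSwinnertonDyer.Rank1Residual.X2.GreenbergVatsalTorsion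
  Summit.BirchSwinnertonDyer.BirchSwinnertonDyer.Theorems.AlignedTransportAtTwoFineRoad

universe u

/-! ## §1 Greenberg–Vatsal structures along a restriction `H¹(H₂, M) → H¹(H₁, M)`, `H₁ ≤ H₂` -/

section Generic

variable {K : Type u} [Field K] [NumberField K]
variable {M : Type u} [AddCommGroup M] [DistribMulAction (absoluteGaloisGroup K) M]
  [TopologicalSpace M] [DiscreteTopology M]

/-- **Restriction preserves the unramified condition**: for `H₁ ≤ H₂` and a finite place `v`, if `c ∈ H¹(H₂, M)` dies on
`H₂ ⊓ I_v` then `res c ∈ H¹(H₁, M)` dies on `H₁ ⊓ I_v` (both composites `H₁ ⊓ I_v → H₂` coincide).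
[cite: GreenbergVatsal2000, §2 p. 17] [cite: SerreGaloisCohomology1997, I §2.4] -/
theorem resOfLe_mem_unramKer {H₁ H₂ : Subgroup (absoluteGaloisGroup K)} (h : H₁ ≤ H₂) (v : HeightOneSpectrum (𝓞 K))
    {c : subgroupH1 H₂ M} (hc : c ∈ unramKer H₂ M v) : resOfLe M h c ∈ unramKer H₁ M v := by
  have hle : inertiaIn H₁ v ≤ inertiaIn H₂ v := fun x hx ↦
    (mem_inertiaIn_iff H₂ v x).2 ⟨h ((mem_inertiaIn_iff H₁ v x).1 hx).1, ((mem_inertiaIn_iff H₁ v x).1 hx).2⟩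
  rw [unramKer, AddMonoidHom.mem_ker] at hc ⊢
  rw [Literature.NumberTheory.EllipticCurves.resOfLe, resH1Hom_resH1Hom]
  have e : resH1Hom ((subgroupInclusion h).comp (inertiaInToH H₁ v)) ((AddMonoidHom.id M).comp (AddMonoidHom.id M))
        (fun _ _ ↦ rfl) c =
      resH1Hom (subgroupInclusion hle) (AddMonoidHom.id M) (fun _ _ ↦ rfl)
        (resH1Hom (inertiaInToH H₂ v) (AddMonoidHom.id M) (fun _ _ ↦ rfl) c) := by
    rw [resH1Hom_resH1Hom]
    exact congrFun (congrArg DFunLike.coe (resH1Hom_congr (by ext; rfl) (by ext; rfl) _ _)) c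
  rw [e, hc, map_zero]

/-- **Restriction preserves Greenberg's condition at `v ∣ p`** for one and the same ordinary datum `N = M⁺_v`:
`c ↦ 0 ∈ H¹(H₂ ⊓ I_v, M/M⁺_v)` implies `res c ↦ 0 ∈ H¹(H₁ ⊓ I_v, M/M⁺_v)`.
[cite: Greenberg1989, §1 p. 98 (4)] [cite: SerreGaloisCohomology1997, I §2.4] -/
theorem resOfLe_mem_greenbergKer {H₁ H₂ : Subgroup (absoluteGaloisGroup K)} (h : H₁ ≤ H₂) {v : HeightOneSpectrum (𝓞 K)}
    (N : LocalDatum K M v) {c : subgroupH1 H₂ M} (hc : c ∈ N.greenbergKer H₂) :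
    resOfLe M h c ∈ N.greenbergKer H₁ := by
  have hle : inertiaIn H₁ v ≤ inertiaIn H₂ v := fun x hx ↦
    (mem_inertiaIn_iff H₂ v x).2 ⟨h ((mem_inertiaIn_iff H₁ v x).1 hx).1, ((mem_inertiaIn_iff H₁ v x).1 hx).2⟩
  rw [LocalDatum.mem_greenbergKer_iff] at hc ⊢
  rw [LocalDatum.greenbergMap, Literature.NumberTheory.EllipticCurves.resOfLe, resH1Hom_resH1Hom]
  have e : resH1Hom ((subgroupInclusion h).comp (inertiaInToH H₁ v)) (N.grMk.comp (AddMonoidHom.id M))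
        (fun _ _ ↦ rfl) c =
      resH1Hom (subgroupInclusion hle) (AddMonoidHom.id N.Gr) (fun _ _ ↦ rfl)
        (resH1Hom (inertiaInToH H₂ v) N.grMk (fun _ _ ↦ rfl) c) := by
    rw [resH1Hom_resH1Hom]
    exact congrFun (congrArg DFunLike.coe (resH1Hom_congr (by ext; rfl) (by ext; rfl) _ _)) c
  rw [e]
  change resH1Hom (subgroupInclusion hle) (AddMonoidHom.id N.Gr) (fun _ _ ↦ rfl) (N.greenbergMap H₂ c) = 0
  rw [hc, map_zero]

variable (p : ℕ) (L : Data K M p) (S₀ : Set (HeightOneSpectrum (𝓞 K)))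

/-- **`res : S^{Σ₀}_M(K̄^{H₂}) → S^{Σ₀}_M(K̄^{H₁})`** for normal `H₁ ≤ H₂ ≤ Γ_K`: restriction commutes with conjugation
(`resOfLe_comp_conjH1`) and preserves both kinds of local condition (§1). [cite: GreenbergVatsal2000, §2 pp. 16–17]
[cite: GreenbergLNM1716, §3 (restriction maps)] -/
theorem resOfLe_mem_gvSelmer {H₁ H₂ : Subgroup (absoluteGaloisGroup K)} [H₁.Normal] [H₂.Normal] (h : H₁ ≤ H₂)
    {c : subgroupH1 H₂ M} (hc : c ∈ gvSelmer H₂ M p L S₀) : resOfLe M h c ∈ gvSelmer H₁ M p L S₀ := by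
  rw [mem_gvSelmer_iff] at hc ⊢
  have hconj : ∀ σ : absoluteGaloisGroup K, conjH1 H₁ M σ (resOfLe M h c) = resOfLe M h (conjH1 H₂ M σ c) := fun σ ↦ by
    have e := congrArg (fun f : subgroupH1 H₂ M →+ subgroupH1 H₁ M ↦ f c) (resOfLe_comp_conjH1_holds (M := M) h σ)
    simp only [AddMonoidHom.comp_apply] at e
    exact e.symm
  refine ⟨fun v hv hpv σ ↦ ?_, fun v hv σ ↦ ?_⟩
  · rw [hconj]
    exact resOfLe_mem_unramKer h v (hc.1 v hv hpv σ)
  · rw [hconj]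
    exact resOfLe_mem_greenbergKer h (L v hv) (hc.2 v hv σ)

/-- **The image of `S^{Σ₀}_M(K̄^{H₂})` under `res` consists of `H₂`-INVARIANT classes of `S^{Σ₀}_M(K̄^{H₁})`**
(`conj_g ∘ res = res` for `g ∈ H₂`, `conjH1_resOfLe_of_mem`). [cite: SerreGaloisCohomology1997, I §2.6] -/
theorem image_resOfLe_gvSelmer_subset_invariants {H₁ H₂ : Subgroup (absoluteGaloisGroup K)} [H₁.Normal] [H₂.Normal]
    (h : H₁ ≤ H₂) :
    resOfLe M h '' (gvSelmer H₂ M p L S₀ : Set (subgroupH1 H₂ M)) ⊆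
      {x | x ∈ gvSelmer H₁ M p L S₀ ∧ ∀ g ∈ H₂, conjH1 H₁ M g x = x} := by
  rintro _ ⟨c, hc, rfl⟩
  exact ⟨resOfLe_mem_gvSelmer p L S₀ h hc, fun g hg ↦ conjH1_resOfLe_of_mem (M := M) h hg c⟩

/-- **Finiteness DESCENDS along an injective restriction**: if `res : H¹(H₂, M) → H¹(H₁, M)` is injective and the `H₂`-invariant
classes of `S^{Σ₀}_M(K̄^{H₁})` form a finite set, then `S^{Σ₀}_M(K̄^{H₂})` is finite. [cite: SerreGaloisCohomology1997, I §2.6] -/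
theorem finite_gvSelmer_of_finite_invariants_of_injective {H₁ H₂ : Subgroup (absoluteGaloisGroup K)} [H₁.Normal] [H₂.Normal]
    (h : H₁ ≤ H₂) (hinj : Function.Injective (resOfLe M h))
    (hfin : Set.Finite {x : subgroupH1 H₁ M | x ∈ gvSelmer H₁ M p L S₀ ∧ ∀ g ∈ H₂, conjH1 H₁ M g x = x}) :
    Set.Finite (gvSelmer H₂ M p L S₀ : Set (subgroupH1 H₂ M)) :=
  Set.Finite.of_finite_image (hfin.subset (image_resOfLe_gvSelmer_subset_invariants p L S₀ h)) hinj.injOn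

end Generic

/-! ## §2 The Klein module `E[2^∞][2]` and the injectivity of `res : H¹(H, E[2^∞][2]) → H¹(H ⊓ ker ρ̄_{E,2}, E[2^∞][2])` -/

section Klein

variable {K : Type} [Field K] (W : WeierstrassCurve K) [W.IsElliptic]

omit [W.IsElliptic] in
/-- `m + m = 0` on `E[2^∞][2]`. [folklore] -/
theorem add_self_torsionBy_two (m : ↥((W.geomPrimaryTorsion 2)[((2 : ℕ) : ℤ)])) : m + m = 0 := by
  rw [← two_nsmul]
  exact AddSubgroup.torsionBy.nsmul m

omit [W.IsElliptic] in
/-- `E[2] ≃ E[2^∞][2]` (both are the points `P` with `2P = 0`). [folklore] -/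
theorem nonempty_geomTorsion_equiv_torsionBy_two :
    Nonempty (W.geomTorsion 2 ≃ ↥((W.geomPrimaryTorsion 2)[((2 : ℕ) : ℤ)])) := by
  refine ⟨{ toFun := fun P ↦ ⟨⟨(P : W.geomPoints), ?_⟩, ?_⟩,
            invFun := fun m ↦ ⟨((m : W.geomPrimaryTorsion 2) : W.geomPoints), ?_⟩,
            left_inv := fun P ↦ Subtype.ext rfl,
            right_inv := fun m ↦ Subtype.ext (Subtype.ext rfl) }⟩
  · exact geomTorsion_le_geomPrimaryTorsion W 2 P.2
  · rw [AddSubgroup.torsionBy.nsmul_iff]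
    apply Subtype.ext
    have hP : (2 : ℤ) • (P : W.geomPoints) = 0 := (mem_geomTorsion_iff W 2 P).1 P.2
    rw [AddSubmonoidClass.coe_nsmul, ZeroMemClass.coe_zero, ← natCast_zsmul]
    exact hP
  · rw [mem_geomTorsion_iff]
    have hm : (2 : ℕ) • m = 0 := AddSubgroup.torsionBy.nsmul m
    have hm' : (2 : ℕ) • ((m : W.geomPrimaryTorsion 2) : W.geomPoints) = 0 := by
      have := congrArg (fun z : ↥((W.geomPrimaryTorsion 2)[((2 : ℕ) : ℤ)]) ↦ ((z : W.geomPrimaryTorsion 2) : W.geomPoints)) hm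
      simpa only [AddSubmonoidClass.coe_nsmul, ZeroMemClass.coe_zero] using this
    rw [← natCast_zsmul] at hm'
    exact hm'

/-- **`#E[2^∞][2] = 4`** when `2 ≠ 0` in `K` (`= #E[2]`, Silverman AEC III.6.4(b)). [cite: SilvermanAEC2009, Cor. III.6.4(b)] -/
theorem natCard_torsionBy_two (hK : (2 : K) ≠ 0) : Nat.card ↥((W.geomPrimaryTorsion 2)[((2 : ℕ) : ℤ)]) = 4 := by
  obtain ⟨e⟩ := nonempty_geomTorsion_equiv_torsionBy_two W
  rw [← Nat.card_congr e]
  exact PerfectDescent.natCard_geomTorsion_two_of_two_ne_zero W hK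

omit [W.IsElliptic] in
/-- An element of `Γ_K` fixing `E[2^∞][2]` pointwise lies in `ker ρ̄_{E,2} = Gal(K̄/K(E[2]))`. [cite: SilvermanAEC2009, III §7] -/
theorem mem_ker_galoisRepTorsion_two_of_forall_smul_torsionBy_eq {g : absoluteGaloisGroup K}
    (hg : ∀ m : ↥((W.geomPrimaryTorsion 2)[((2 : ℕ) : ℤ)]), g • m = m) : g ∈ (W.galoisRepTorsion 2).ker := by
  rw [mem_ker_galoisRepTorsion_iff' W 2 g]
  intro P hP
  have hPt : P ∈ W.geomTorsion ((2 : ℕ) : ℤ) := (mem_geomTorsion_iff W _ P).2 hP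
  have hPp : P ∈ W.geomPrimaryTorsion 2 := geomTorsion_le_geomPrimaryTorsion W 2 hPt
  have h2 : (⟨P, hPp⟩ : W.geomPrimaryTorsion 2) ∈ (W.geomPrimaryTorsion 2)[((2 : ℕ) : ℤ)] := by
    rw [AddSubgroup.torsionBy.nsmul_iff]
    apply Subtype.ext
    rw [AddSubmonoidClass.coe_nsmul, ZeroMemClass.coe_zero, ← natCast_zsmul]
    exact hP
  have e := congrArg (fun z : ↥((W.geomPrimaryTorsion 2)[((2 : ℕ) : ℤ)]) ↦ ((z : W.geomPrimaryTorsion 2) : W.geomPoints))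
    (hg ⟨⟨P, hPp⟩, h2⟩)
  change ((g • (⟨P, hPp⟩ : W.geomPrimaryTorsion 2) : W.geomPrimaryTorsion 2) : W.geomPoints) = P at e
  rwa [primaryComponent.coe_smul] at e

variable [NumberField K]

/-- **PERFECT DESCENT for `E[2^∞][2]`-coefficients: `res : H¹(H, E[2^∞][2]) → H¹(H ⊓ Gal(K̄/K(E[2])), E[2^∞][2])` is INJECTIVE
for EVERY `H ≤ Γ_K`** (att-p3 g4 `PerfectDescent.resOfLe_injective_of_klein`: `H¹(Q̄, V₄) = 0` for every `Q̄ ≤ Aut(V₄) ≅ S₃`).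
[cite: SerreGaloisCohomology1997, I §2.6 (inflation–restriction)] [cite: SilvermanAEC2009, X.4 (2-descent)] -/
theorem resOfLe_torsionBy_two_injective (H : Subgroup (absoluteGaloisGroup K)) :
    Function.Injective (resOfLe (↥((W.geomPrimaryTorsion 2)[((2 : ℕ) : ℤ)]))
      (inf_le_left : H ⊓ (W.galoisRepTorsion 2).ker ≤ H)) := by
  have hK : (2 : K) ≠ 0 := two_ne_zero
  exact PerfectDescent.resOfLe_injective_of_klein (M := ↥((W.geomPrimaryTorsion 2)[((2 : ℕ) : ℤ)])) inf_le_left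
    (natCard_torsionBy_two W hK) (add_self_torsionBy_two W)
    (fun g hg hfix ↦ ⟨hg, mem_ker_galoisRepTorsion_two_of_forall_smul_torsionBy_eq W hfix⟩)

end Klein

/-! ## §3 `K = ℚ`, `p = 2`: T at `(W, κ)` from finiteness over the sextic tower `ℚ_∞(E[2])` -/

section Rat

open Summit.BirchSwinnertonDyer.Rank1Residual.X2.GreenbergVatsalReductionDatum
  Summit.BirchSwinnertonDyer.Rank1Residual.X2.GreenbergVatsalTorsionCurve

variable (W : WeierstrassCurve ℚ) [W.IsElliptic] [W.IsGloballyMinimal] (κ : ZpExtension ℚ 2)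
  (S₀ : Set (HeightOneSpectrum (𝓞 ℚ)))

/-- **`S^{Σ₀}_{E[2]}(ℚ_∞)` finite ⟹ `Sel_{2^∞}(W/ℚ_∞)[2]` finite** (hypothesis satisfiable only for `Δ_W < 0`, see SCOPE) — `W/ℚ`
globally minimal, `2 ∤ Δ_W` (good reduction at `2`),
`κ` ANY `ℤ₂`-extension of `ℚ`, `Σ₀ ⊇` the odd bad primes, Greenberg's reduction datum at `2`. The 2-torsion Selmer classes lie in
`S^{Σ₀}_{E[2^∞]}(ℚ_∞) ⊓ H¹[2]` (tree `selmerInfty_le_gvSelmerInfty_reductionData`: the classical local conditions imply unramified at good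
`v ∤ 2` and Greenberg's condition at `2`), which is the image of `S^{Σ₀}_{E[2]}(ℚ_∞) := S^{Σ₀}_{E[2^∞][2]}(ℚ_∞)` under `α = ι_*` (GV Prop. 2.8
without `H⁰ = 0`, tree `map_gvSelmer_torsion_eq`; `E[2^∞]` unramified outside `Σ₀ ∪ {2}`, `I_2` trivial on `Ẽ[2^∞]`, both discharged).
[cite: GreenbergVatsal2000, §2 Prop. (2.8) and p. 19 (6)] [cite: GreenbergLNM1716, §2 pp. 69–75] -/
theorem finite_selmer_twoTorsion_of_finite_gvSelmer_twoTorsion (hΔ : ¬ (2 : ℤ) ∣ minimalDiscriminantInt W)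
    (hS : ∀ v : HeightOneSpectrum (𝓞 ℚ), v ∉ S₀ → ((2 : ℕ) : 𝓞 ℚ) ∉ v.asIdeal → W.HasGoodReductionAt v)
    (hfin : Set.Finite (gvSelmer κ.kerSubgroup (↥((W.geomPrimaryTorsion 2)[((2 : ℕ) : ℤ)])) 2
      (torsionData (reductionData W 2 hΔ) 2) S₀ :
        Set (subgroupH1 κ.kerSubgroup ↥((W.geomPrimaryTorsion 2)[((2 : ℕ) : ℤ)])))) :
    Set.Finite {s : W.selmerInfty κ | 2 • s = 0} := by
  -- the image of `S^{Σ₀}_{E[2]}` under `α` is `S^{Σ₀}_{E[2^∞]} ⊓ H¹[2]`, hence finite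
  have himg := map_gvSelmer_torsion_eq κ.kerSubgroup (W.geomPrimaryTorsion 2) 2 (reductionData W 2 hΔ) S₀ 2
    (continuous_smul_curve W 2) (divisible_curve W 2) (unramified_outside W 2 S₀ hS) (reductionData_htriv W 2 hΔ)
  have hfin' : Set.Finite ((gvSelmer κ.kerSubgroup (W.geomPrimaryTorsion 2) 2 (reductionData W 2 hΔ) S₀ ⊓
      (subgroupH1 κ.kerSubgroup (W.geomPrimaryTorsion 2))[((2 : ℕ) : ℤ)] :
        AddSubgroup (subgroupH1 κ.kerSubgroup (W.geomPrimaryTorsion 2))) :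
      Set (subgroupH1 κ.kerSubgroup (W.geomPrimaryTorsion 2))) := by
    rw [← himg, AddSubgroup.coe_map]
    exact hfin.image _
  -- `Sel[2]` embeds into it by the coercion `Sel ↪ H¹(ℚ_∞, E[2^∞])`
  have hle := selmerInfty_le_gvSelmerInfty_reductionData W 2 S₀ κ hΔ hS
  refine Set.Finite.of_finite_image (hfin'.subset ?_)
    (Subtype.coe_injective.injOn (s := {s : W.selmerInfty κ | 2 • s = 0})
      (f := fun s : W.selmerInfty κ ↦ (s : W.subgroupH1 2 κ.kerSubgroup)))
  rintro _ ⟨s, hs, rfl⟩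
  refine ⟨hle s.2, ?_⟩
  change (s : W.subgroupH1 2 κ.kerSubgroup) ∈ (subgroupH1 κ.kerSubgroup (W.geomPrimaryTorsion 2))[((2 : ℕ) : ℤ)]
  rw [AddSubgroup.torsionBy.nsmul_iff]
  have := congrArg (fun z : W.selmerInfty κ ↦ (z : W.subgroupH1 2 κ.kerSubgroup)) hs
  simpa only [AddSubmonoidClass.coe_nsmul, ZeroMemClass.coe_zero] using this

/-- **T at `(W, κ)` from the sextic tower — finiteness form** (hypothesis satisfiable only for `Δ_W < 0`, see SCOPE in the module
docstring). `W/ℚ` globally minimal with `2 ∤ Δ_W`, `κ` any `ℤ₂`-extension, `Σ₀ ⊇` odd bad primes. IF the `Gal(ℚ̄/ℚ_∞)`-INVARIANT classes of Greenberg–Vatsal's ordinary `E[2]`-structure over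
`F_∞ = ℚ_∞(E[2])` — continuous homomorphisms `φ : Gal(ℚ̄/F_∞) → E[2]` unramified at `w ∤ 2Σ₀` with `φ(I_w) ⊆ Ê[2]` at `w ∣ 2`, taken
at every conjugate place — form a FINITE set, THEN `Sel_{2^∞}(W/ℚ_∞)[2]` is finite: §1 (restriction lands in the invariants) + §2
(restriction is injective, `H¹(Gal(F_∞/ℚ_∞), E[2]) = 0` in the strong form of part II) + the previous theorem.
[cite: GreenbergVatsal2000, §2 Prop. (2.8)] [cite: SerreGaloisCohomology1997, I §2.6] -/
theorem finite_selmer_twoTorsion_of_finite_invariants_divisionTower (hΔ : ¬ (2 : ℤ) ∣ minimalDiscriminantInt W)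
    (hS : ∀ v : HeightOneSpectrum (𝓞 ℚ), v ∉ S₀ → ((2 : ℕ) : 𝓞 ℚ) ∉ v.asIdeal → W.HasGoodReductionAt v)
    (hfin : Set.Finite {x : subgroupH1 (κ.kerSubgroup ⊓ (W.galoisRepTorsion 2).ker) ↥((W.geomPrimaryTorsion 2)[((2 : ℕ) : ℤ)]) |
      x ∈ gvSelmer (κ.kerSubgroup ⊓ (W.galoisRepTorsion 2).ker) (↥((W.geomPrimaryTorsion 2)[((2 : ℕ) : ℤ)])) 2
          (torsionData (reductionData W 2 hΔ) 2) S₀ ∧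
        ∀ g ∈ κ.kerSubgroup,
          conjH1 (κ.kerSubgroup ⊓ (W.galoisRepTorsion 2).ker) (↥((W.geomPrimaryTorsion 2)[((2 : ℕ) : ℤ)])) g x = x}) :
    Set.Finite {s : W.selmerInfty κ | 2 • s = 0} :=
  finite_selmer_twoTorsion_of_finite_gvSelmer_twoTorsion W κ S₀ hΔ hS
    (finite_gvSelmer_of_finite_invariants_of_injective 2 (torsionData (reductionData W 2 hΔ) 2) S₀ inf_le_left
      (resOfLe_torsionBy_two_injective W κ.kerSubgroup) hfin)

/-- **THE REGISTERED STUB T OF LINE `birth` AT `(W, κ)` FROM THE SEXTIC TOWER** (the lead's O1, sufficiency half, print-free;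
hypothesis satisfiable only for `Δ_W < 0` — for `Δ_W > 0` the `∞`-free structure carries Greenberg's archimedean `Λ/2`, see SCOPE): for
`W/ℚ` globally minimal with `2 ∤ Δ_W`, ANY `ℤ₂`-extension `κ` with a topological generator, `Σ₀ ⊇` odd bad primes — if the
`Gal(ℚ̄/ℚ_∞)`-invariant classes of `S^{Σ₀}_{E[2]}(ℚ_∞(E[2]))` (ordinary line condition at `2`) form a finite set, then for EVERY
topological generator `γ` and EVERY dual datum `D : W.SelmerDualData κ γ`, `X(W/ℚ_∞)` is `Λ`-torsion with `μ₂ = 0` (PART XVI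
`finite_pTorsion_iff_forall`). On the seed cell (good ordinary at `2`, `E(ℚ)[2] = 0`, `Δ ∉ ℚ²`) the field `ℚ_∞(E[2])` is the
`S₃`-sextic tower and, modulo PRINT, C2 at `W` IS this `μ₂ = 0 ∧` torsion (p583329). [cite: GreenbergLNM1716, §1 Conj. 1.11]
[cite: GreenbergVatsal2000, §2 Prop. (2.8)] [cite: SerreGaloisCohomology1997, I §2.6] -/
theorem isTorsion_and_mu_eq_zero_of_finite_invariants_divisionTower (hΔ : ¬ (2 : ℤ) ∣ minimalDiscriminantInt W)
    (hS : ∀ v : HeightOneSpectrum (𝓞 ℚ), v ∉ S₀ → ((2 : ℕ) : 𝓞 ℚ) ∉ v.asIdeal → W.HasGoodReductionAt v)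
    {γ₀ : absoluteGaloisGroup ℚ} (hγ₀ : κ.IsTopGenerator γ₀)
    (hfin : Set.Finite {x : subgroupH1 (κ.kerSubgroup ⊓ (W.galoisRepTorsion 2).ker) ↥((W.geomPrimaryTorsion 2)[((2 : ℕ) : ℤ)]) |
      x ∈ gvSelmer (κ.kerSubgroup ⊓ (W.galoisRepTorsion 2).ker) (↥((W.geomPrimaryTorsion 2)[((2 : ℕ) : ℤ)])) 2
          (torsionData (reductionData W 2 hΔ) 2) S₀ ∧
        ∀ g ∈ κ.kerSubgroup,
          conjH1 (κ.kerSubgroup ⊓ (W.galoisRepTorsion 2).ker) (↥((W.geomPrimaryTorsion 2)[((2 : ℕ) : ℤ)])) g x = x}) :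
    ∀ (γ : absoluteGaloisGroup ℚ), κ.IsTopGenerator γ → ∀ D : W.SelmerDualData κ γ, D.IsTorsion ∧ D.mu = 0 :=
  (finite_pTorsion_iff_forall W κ hγ₀).1
    (finite_selmer_twoTorsion_of_finite_invariants_divisionTower W κ S₀ hΔ hS hfin)

end Rat

end Summit.BirchSwinnertonDyer.BirchSwinnertonDyer.Theorems.AlignedTransportAtTwoSeedTwoTorsion

end
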